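import Summits.ValiantsHypothesis.ValiantsHypothesis.Theses.ScaledPencil
import Summits.ValiantsHypothesis.ValiantsHypothesis.Theses.DetQP
import Summits.ValiantsHypothesis.ValiantsHypothesis.Theorems.DetQPDetqpSuperquadraticGaugeTransfer
import Summits.ValiantsHypothesis.ValiantsHypothesis.Theorems.ScaledPencilNormalFormSplit

/-!
# Crux `DetqpSuperquadratic` (stmt-ValiantsHypothesis-0318) — line `scaled-pencil`: the load-bearing stub is crux-EQUIVALENT

Registered line `Cruxes/DetqpSuperquadratic/Lines/scaled_pencil.lean` has two stubs: `stub_gaugeTransfer`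
(LANDED, `Theorems.DetQP.DetqpSuperquadratic.stub_gaugeTransfer`, p560177) and the load-bearing
`stub_scaledPencilSuperquadratic = Theses.ScaledPencil.ScaledPencilSuperquadratic` (item stmt-5318 verbatim,
open-problem grade). This file records, as tree theorems, that the load-bearing stub is not a weakening of the
crux but a REFORMULATION of it:

* `scaledPencilSuperquadratic_of_detqpSuperquadratic` — crux ⇒ gauge form: a pencil `(Λ, L)` of size `m` with
  `det (Λ + Σ_v x_v L_v) = per_n` is an affine determinantal representation of size `m`
  (`Theorems.pencilOfAffine_proof`, stmt-5322 ✓), so `m ≥ dc(per_n) ≥ n^{2+ε}`; the gauge hypotheses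
  (scaling, balancing, θ-stability) are not even used.
* `detqpSuperquadratic_iff_scaledPencilSuperquadratic` — with the landed gauge transfer and the proved normal form
  (`Theorems.ScaledPencilNormalFormSplit.normalForm_proof`, stmt-5317 ✓): `DetQP.DetqpSuperquadratic ↔
  ScaledPencil.ScaledPencilSuperquadratic`.
* `scaledPencil_detqpSuperquadratic_iff_scaledPencilSuperquadratic` — the same with route ScaledPencil's own
  rendering of item 0318 on the left.

Honest framing: bookkeeping only. The value of the scaled-pencil line is that the gauge's identities
(`Λ Λᴴ + Σ L_v L_vᴴ = α I = Λᴴ Λ + Σ L_vᴴ L_v`, doubly balanced norms, strict expansion of proper subspaces) come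
FOR FREE to whoever attacks the crux; the superquadratic bound `dc(per_n) ≥ n^{2+ε}` itself stays OPEN (best in
print: `n²/2`, Mignon–Ressayre 2004). Nothing here bears on `VP ≠ VNP`.
-/

-- Sub = Summit layout duplicates the namespace component
set_option linter.dupNamespace false

namespace Summit.ValiantsHypothesis.ValiantsHypothesis.Theorems.DetQP.DetqpSuperquadratic

open Summit.ValiantsHypothesis.ValiantsHypothesis
open Literature.Computability.AlgebraicComplexity

/-- **Crux ⇒ gauge form.** If `dc(per_n) ≥ n^{2+ε}` for all large `n` (`DetQP.DetqpSuperquadratic`), then every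
pencil `(Λ, L)` of size `m` computing `per_n` — in particular every normal-form pencil — has `n^{2+ε} ≤ m`
(`ScaledPencil.ScaledPencilSuperquadratic`): the pencil is an affine determinantal representation of size `m`
(`pencilOfAffine_proof`), so `dc(per_n) ≤ m` (`determinantalComplexity_le_of_hasDetRepr`). The scaling /
balancing / stability hypotheses of the gauge are not used. -/
theorem scaledPencilSuperquadratic_of_detqpSuperquadratic :
    Theses.DetQP.DetqpSuperquadratic → Theses.ScaledPencil.ScaledPencilSuperquadratic := by
  intro h
  unfold Theses.DetQP.DetqpSuperquadratic at h
  unfold Theses.ScaledPencil.ScaledPencilSuperquadratic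
  obtain ⟨ε, hε, n₀, hn₀⟩ := h
  refine ⟨ε, hε, n₀, fun n hn m Λ L hdet _ _ => ?_⟩
  have hpa := Theorems.pencilOfAffine_proof
  unfold Theses.ScaledPencil.PencilOfAffine at hpa
  have hrep : HasDetRepr (perPoly (Fin n) ℂ) m := (hpa n m).mpr ⟨Λ, L, hdet⟩
  have hdc : determinantalComplexity (perPoly (Fin n) ℂ) ≤ m :=
    determinantalComplexity_le_of_hasDetRepr hrep
  exact (hn₀ n hn).trans (by exact_mod_cast hdc)

/-- **The scaled-pencil line's load-bearing stub is crux-equivalent.**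
`DetQP.DetqpSuperquadratic ↔ ScaledPencil.ScaledPencilSuperquadratic`: `→` is
`scaledPencilSuperquadratic_of_detqpSuperquadratic`; `←` is the landed gauge transfer `stub_gaugeTransfer`
fed with the proved normal form `ScaledPencilNormalFormSplit.normalForm_proof` (stmt-5317). -/
theorem detqpSuperquadratic_iff_scaledPencilSuperquadratic :
    Theses.DetQP.DetqpSuperquadratic ↔ Theses.ScaledPencil.ScaledPencilSuperquadratic :=
  ⟨scaledPencilSuperquadratic_of_detqpSuperquadratic,
    stub_gaugeTransfer Theorems.ScaledPencilNormalFormSplit.normalForm_proof⟩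

/-- The same equivalence with route ScaledPencil's own rendering of item stmt-0318
(`ScaledPencil.DetqpSuperquadratic`, definitionally the body of `DetQP.DetqpSuperquadratic`) on the left:
`ScaledPencil.DetqpSuperquadratic ↔ ScaledPencil.ScaledPencilSuperquadratic`. -/
theorem scaledPencil_detqpSuperquadratic_iff_scaledPencilSuperquadratic :
    Theses.ScaledPencil.DetqpSuperquadratic ↔ Theses.ScaledPencil.ScaledPencilSuperquadratic := by
  have h := detqpSuperquadratic_iff_scaledPencilSuperquadratic
  unfold Theses.DetQP.DetqpSuperquadratic at h
  unfold Theses.ScaledPencil.DetqpSuperquadratic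
  exact h

end Summit.ValiantsHypothesis.ValiantsHypothesis.Theorems.DetQP.DetqpSuperquadratic
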